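import Literature.NumberTheory.Transcendental.AnalytificationMorphismsProofs
import Literature.NumberTheory.Transcendental.AnalytificationProduct
import HarnessLib

/-!
# Holomorphic maps out of a product of smooth projective varieties are algebraic

Family `hodge`, layer `Literature/NumberTheory/Transcendental`. A corollary of the two proof files
`AnalytificationMorphismsProofs.lean` (GAGA for maps, `arapura2012_cor_15_4_6_holds`: Arapura 2012
Cor. 15.4.6 / Mumford, *Algebraic Geometry I* (1981), §4B (4.14)) and `AnalytificationProduct.lean`
(`IsAnalytification.prod`: `(X ×ₖ Y)^an = X^an × Y^an`, Serre GAGA §2 n°5 p. 9), stated in the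
form consumers need: for `X`, `Y`, `Z` smooth projective over `ℂ` with analytifications
`φ : M → X(ℂ)`, `ψ : M' → Y(ℂ)`, `ζ : M'' → Z(ℂ)` (holomorphic atlases) and a map `f : M × M' → M''`
holomorphic for MATHLIB'S product complex structure `𝓘(ℂ, E).prod 𝓘(ℂ, E')`, there is a morphism
`g : X ×_ℂ Y ⟶ Z` with `ζ (f (a, b)) = g(ℂ)(φ a, ψ b)`. Typical use (Mumford 1981 §4B; Mumford,
*Abelian Varieties* §1): a holomorphic group law `T × T → T` on the analytification `T` of a smooth
projective `X` is the analytification of a morphism `X ×_ℂ X ⟶ X`. The only work here is the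
bookkeeping `𝓘(ℂ, E × E') = 𝓘(ℂ, E).prod 𝓘(ℂ, E')` (Mathlib `modelWithCornersSelf_prod`) between
the self-model spelling of `Arapura2012_Cor_15_4_6` and the product-model spelling of Mathlib's
manifold library. No definitions, no named facts.

## References

* D. Mumford, *Algebraic Geometry I: Complex Projective Varieties* (1981), §4B (4.14), p. 67.
  [Mumford1981]
* D. Arapura, *Algebraic Geometry over the Complex Numbers* (2012), §15.4 Cor. 15.4.6. [Arapura2012]
* J.-P. Serre, GAGA, Ann. Inst. Fourier 6 (1956), §2 n°5 p. 9. [SerreGAGA1956]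
-/

noncomputable section

open scoped Manifold ContDiff
open CategoryTheory AlgebraicGeometry MonoidalCategory
open Literature.AlgebraicGeometry.Motives (AlgPoints ComplexPoints SchemeOver IsSmoothProjective)

namespace Literature.NumberTheory.Transcendental

/-- **GAGA for maps out of a product** (Mumford, *Algebraic Geometry I* (1981), §4B (4.14)
Corollary, p. 67, applied to the smooth projective variety `X × Y`; Arapura 2012 Cor. 15.4.6;
Serre GAGA §2 n°5 p. 9 for `(X × Y)^h = X^h × Y^h`). Let `X`, `Y`, `Z` be smooth projective over `ℂ`
with analytifications `φ : M → X(ℂ)`, `ψ : M' → Y(ℂ)`, `ζ : M'' → Z(ℂ)` carrying holomorphic atlases,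
and let `f : M × M' → M''` be holomorphic for the product complex structure
`𝓘(ℂ, E).prod 𝓘(ℂ, E')`. Then `f` is induced by a morphism `g : X ×_ℂ Y ⟶ Z`:
`ζ (f p) = g(ℂ)(φ p.1, ψ p.2)` for all `p` (pairs of points through `AlgPoints.prodEquiv`). Proof:
`p ↦ (φ p.1, ψ p.2)` is an analytification of the smooth projective `X ×_ℂ Y`
(`IsAnalytification.prod`, `IsSmoothProjective.tensor_holds`), so `arapura2012_cor_15_4_6_holds`
applies. [cite: Mumford1981, §4B (4.14) Corollary, p. 67] [cite: Arapura2012, §15.4 Cor. 15.4.6] -/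
theorem exists_hom_tensorObj_of_mdifferentiable {n m e : ℕ} {X Y Z : SchemeOver ℂ}
    (hX : IsSmoothProjective n X) (hY : IsSmoothProjective m Y) (hZ : IsSmoothProjective e Z)
    {E : Type} [NormedAddCommGroup E] [NormedSpace ℂ E] [FiniteDimensional ℂ E]
    {M : Type} [TopologicalSpace M] [ChartedSpace E M] [IsManifold 𝓘(ℂ, E) ω M]
    {φ : M → ComplexPoints X} (hφ : IsAnalytification E X n φ)
    {E' : Type} [NormedAddCommGroup E'] [NormedSpace ℂ E'] [FiniteDimensional ℂ E']
    {M' : Type} [TopologicalSpace M'] [ChartedSpace E' M'] [IsManifold 𝓘(ℂ, E') ω M']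
    {ψ : M' → ComplexPoints Y} (hψ : IsAnalytification E' Y m ψ)
    {E'' : Type} [NormedAddCommGroup E''] [NormedSpace ℂ E''] [FiniteDimensional ℂ E'']
    {M'' : Type} [TopologicalSpace M''] [ChartedSpace E'' M''] [IsManifold 𝓘(ℂ, E'') ω M'']
    {ζ : M'' → ComplexPoints Z} (hζ : IsAnalytification E'' Z e ζ)
    (f : M × M' → M'') (hf : MDifferentiable (𝓘(ℂ, E).prod 𝓘(ℂ, E')) 𝓘(ℂ, E'') f) :
    ∃ g : X ⊗ Y ⟶ Z, ∀ p : M × M',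
      ζ (f p) = AlgPoints.map g (AlgPoints.prodEquiv.symm (φ p.1, ψ p.2)) := by
  -- instances carried by `X`, `Y`
  haveI : SmoothOfRelativeDimension n X.hom := hX.smoothOfRelativeDimension
  haveI : Smooth X.hom := SmoothOfRelativeDimension.smooth n X.hom
  haveI : LocallyOfFiniteType X.hom := inferInstance
  haveI : IsProper X.hom := IsSmoothProjective.isProper_holds hX
  haveI : SmoothOfRelativeDimension m Y.hom := hY.smoothOfRelativeDimension
  haveI : Smooth Y.hom := SmoothOfRelativeDimension.smooth m Y.hom
  haveI : LocallyOfFiniteType Y.hom := inferInstance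
  haveI : IsProper Y.hom := IsSmoothProjective.isProper_holds hY
  have hXY : IsSmoothProjective (n + m) (X ⊗ Y) := IsSmoothProjective.tensor_holds hX hY
  -- the product analytification and the product manifold in the self-model spelling
  have hprod := IsAnalytification.prod hφ hψ
  letI : ChartedSpace (E × E') (M × M') := prodChartedSpace E M E' M'
  haveI : IsManifold 𝓘(ℂ, E × E') ω (M × M') := by
    rw [modelWithCornersSelf_prod]
    exact inferInstanceAs (IsManifold (𝓘(ℂ, E).prod 𝓘(ℂ, E')) ω (M × M'))
  have hf' : MDifferentiable 𝓘(ℂ, E × E') 𝓘(ℂ, E'') f := by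
    rw [modelWithCornersSelf_prod]
    exact hf
  exact arapura2012_cor_15_4_6_holds (X ⊗ Y) Z hXY hZ (E × E') (M × M') _ hprod E'' M'' ζ hζ f hf'

end Literature.NumberTheory.Transcendental
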